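import Literature.NumberTheory.Automorphic.UnboundedDenominators

/-!
# The unbounded denominators theorem (Calegari–Dimitrov–Tang) — §4.4 ⇒ §4.3: Theorem 4.3.1 from Lemma 4.4.4

Fourth sibling of `Literature/NumberTheory/Automorphic/UnboundedDenominators.lean` (the named fact
`CalegariDimitrovTang2025_unboundedDenominators`), after `UnboundedDenominatorsProofs.lean`
(§4.1 Wohlfahrt level, §4.3 ¶1 `f(pτ)`, Proposition 4.3.5 skeleton),
`UnboundedDenominatorsReductions.lean` (the outer reductions down to the core case for the groups
`G_N`) and `UnboundedDenominatorsGammaInvariance.lean` (the conclusion as `Γ(N)`-invariance).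
Sorry-free theorems only; NO definition, NO named fact (D-0026). Source: F. Calegari,
V. Dimitrov, Y. Tang, *The unbounded denominators conjecture*, J. Amer. Math. Soc. **38** (2025),
627–702 = arXiv:2109.09040v4; numbering below is the PUBLISHED one (§4.3 Theorem 4.3.1, §4.4
Lemma 4.4.1 (Serre–Berger), Lemma 4.4.4, display (4.4.9)); arXiv v1 has instead Proposition 28,
Lemma 29 ("control the level") and Lemma 30.

## What is proved

The tree's map of CDT's proof (`UnboundedDenominatorsProofs.lean`, end) lists "Theorems
4.3.1–4.3.2 and §§4.4–4.6" as not formalized. This file does the GROUP THEORY of §4.4 that turns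
Lemma 4.4.4 into Theorem 4.3.1, with Lemma 4.4.4 in HYPOTHESIS form:

* `sup_ker_eq_top_of_surjective_prod` — the kernel argument behind (4.4.9): if
  `(f, g) : D ↠ X × Y` is surjective then `ker f ⊔ ker g = ⊤` (recorded abstractly; the concrete
  use below is inlined).
* `Gamma_inf_Gamma0_le_sup_of_forall_exists_conjGL`, `…_of_surjective` — display **(4.4.9)₀**:
  `Γ(N) ∩ Γ₀(p) ≤ ⟨G ∩ Γ(N p), A⁻¹ G A ∩ Γ(N) ∩ Γ₀(p)⟩` for `N`, `p` coprime, from Lemma 4.4.4 —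
  either in the "diagonal" form actually consumed (for each `d ∈ Γ(N) ∩ Γ₀(p)` some
  `u ∈ Γ(N) ∩ Γ₀(p)` has `u d⁻¹ ∈ G ∩ Γ(p)` and `A u A⁻¹ ∈ G`, i.e. `(f₁, f₂, π) u = (f₁ d, 1, π d)`)
  or as the full surjectivity `(f₁, f₂, π) : Γ(N) ∩ Γ₀(p) ↠ S × S × B` with the classes of
  `S = ⟨E, Γ(N)⟩/G = Γ(N)/(G ∩ Γ(N))` and `B` represented by elements. Here `A ∈ GL₂(ℝ)` is
  arbitrary in the statements (CDT: `A = diag(p, 1)`), and `A⁻¹ G A ∩ SL₂(ℤ)` is Mathlib's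
  `CongruenceSubgroup.conjGL G A`.
* `Gamma_mul_le_of_inf_le_of_conjGL_inf_le` — hence any subgroup containing `G ∩ Γ(N p)` and
  `A⁻¹ G A ∩ Γ(N) ∩ Γ₀(p)` contains `Γ(N p)` ("these groups together generate a congruence subgroup").
* `forall_mem_Gamma_slash_slash_eq_of_forall_exists_conjGL` — for a weight-`k` modular form `f`
  on `G`, if `f ∣ₖ A` (`= p^{k-1} f(pτ)` for `A = diag(p, 1)`, a form on `A⁻¹ G A ∩ SL₂(ℤ)`,
  cf. `exists_modularForm_conjGL_apply_diag_smul` of the proofs file) is also invariant under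
  `G ∩ Γ(N p)`, then it is invariant under `Γ(N p)`;
  `forall_mem_Gamma_slash_eq_of_forall_exists_conjGL` — and then `f` itself is invariant under
  `Γ(N p²)` (`A⁻¹ Γ(N p²) A ⊆ Γ(N p)`).
* `exists_congruence_modularForm_of_slash_diag_invariant[_of_surjective]` — **Theorem 4.3.1 in
  hypothesis form**: under Lemma 4.4.4 (diagonal form / full form), if `f ∣ₖ A` is invariant under
  `G ∩ Γ(N p)` then `f` is a modular form on a congruence subgroup. Contrapositively, as printed:
  for noncongruence `f`, `f(pτ)` is not invariant under `G ∩ Γ(N p)`, so does not lie in the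
  `M_{Np}`-algebra generated by `R_N` (whose elements are invariant under `G ∩ ⟨E, Γ(N p)⟩`; the
  field-theoretic consequence Theorem 4.3.2, `[R_{Np} : M_{Np}] ≥ 2 [R_N : M_N]`, needs the spaces
  `R_N`, `M_N` of Definition 4.2.1, not yet in the tree).

## A remark on `E = {±1}` (why `Γ(N) ∩ Γ₀(p)` and not `⟨E, Γ(N)⟩ ∩ Γ₀(p)`)

CDT state Lemma 4.4.4 and (4.4.9) on `⟨E, Γ(N)⟩ ∩ Γ₀(p)` with "`π … whose kernel is Γ(Np)`".
On that group the kernel of reduction mod `p` is the index-2 overgroup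
`Γ(Np) ∪ {γ ≡ -1 (N), γ ≡ 1 (p)}` of `Γ(Np)`, and `ker (f₁, π) = G ∩ ker π` then contains elements
`g ≡ (-1 mod N, 1 mod p)` under which `f(pτ)` need not be invariant; the kernel argument for
Theorem 4.3.1 therefore has to be run on `Γ(N) ∩ Γ₀(p)`, where `ker π = Γ(N p)` exactly and
`ker (f₁, π) = G ∩ Γ(N p)`. This is harmless: CDT's proof of Lemma 4.4.4 itself passes to
`Γ(N) ∩ Γ₀(p)` ("`S ≃ Γ(N)/SG` and so the map `(f₁, f₂)` remains surjective after restriction to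
`Γ(N) ∩ Γ₀(p)`", followed by the cohomological argument on `Γ(N) ∩ Γ₀(p)`, `Γ(N) ∩ Γ₁(p)`), i.e.
it proves the statement used here. (Equivalently one may keep `⟨E, Γ(N)⟩ ∩ Γ₀(p)` and twist `π`
by the sign character mod `N`.) Note that the shortcut of CDT Remark 4.4.8 (using the image
`(1, 1, -I)` of `E` to pass to `B/⟨E, U⟩` of order `(p-1)/2`) concerns the `⟨E, Γ(N)⟩`-version only.

## What remains of CDT §4 after this file

Exactly Lemma 4.4.4 on `Γ(N) ∩ Γ₀(p)` — Lemma 4.4.1 (the amalgam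
`⟨E, Γ(N)⟩ ⋆ A⁻¹⟨E, Γ(N)⟩A ≅` the `±1 mod N` congruence subgroup of `SL₂(ℤ[1/p])` [Ser80, Tho89,
Ber94] and the congruence subgroup property of `SL₂(ℤ[1/p])` [Men67, Ser70], with Wohlfahrt's
theorem, in the tree) upgraded by the Borel factor (§4.5 Theorem 4.5.2, §4.6 Lemma 4.6.3) — and
the field theory of `R_N`, `M_N` (Definition 4.2.1, Lemmas 4.2.2–4.2.3, Theorem 4.3.2, (4.3.3)).

## References

* [CalegariDimitrovTang2025] F. Calegari, V. Dimitrov, Y. Tang, The unbounded denominators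
  conjecture, J. Amer. Math. Soc. 38 (2025), 627–702; arXiv:2109.09040. §4.3 (Theorem 4.3.1),
  §4.4 (Lemmas 4.4.1, 4.4.4, display (4.4.9), Remark 4.4.8).
-/

noncomputable section

namespace Literature.NumberTheory.Automorphic

open scoped MatrixGroups ModularForm
open CongruenceSubgroup Matrix.SpecialLinearGroup

/-! ### A. The kernel argument -/

/-- **The kernel argument** of [cite: CalegariDimitrovTang2025, §4.4, proof of display (4.4.9)]:
if two homomorphisms `f : D → X`, `g : D → Y` are jointly surjective, `(f, g) : D ↠ X × Y`, then
`D` is generated by `ker f` and `ker g` — indeed `D = (ker g) · (ker f)`: for `d ∈ D` pick `u`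
with `(f, g)(u) = (1, g d)`; then `u ∈ ker f`, `d u⁻¹ ∈ ker g`. (CDT: "the image of `(f₁, f₂, π)`
contains the elements `(x, 0, z)` and `(0, y, 0)` … the pre-images of these elements clearly lie
in `ker(f₂)` and `ker((f₁, π))` respectively … But then the pre-image of any element lies in `K`.") -/
theorem sup_ker_eq_top_of_surjective_prod {D X Y : Type*} [Group D] [Group X] [Group Y]
    (f : D →* X) (g : D →* Y) (h : Function.Surjective (f.prod g)) : f.ker ⊔ g.ker = ⊤ := by
  rw [eq_top_iff]
  intro d _
  obtain ⟨u, hu⟩ := h (1, g d)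
  have hfu : f u = 1 := by simpa using congr_arg Prod.fst hu
  have hgu : g u = g d := by simpa using congr_arg Prod.snd hu
  have h1 : d * u⁻¹ ∈ g.ker := by
    rw [MonoidHom.mem_ker, map_mul, map_inv, hgu, mul_inv_cancel]
  have h2 : u ∈ f.ker := hfu
  rw [show d = d * u⁻¹ * u by group]
  exact Subgroup.mul_mem _ (Subgroup.mem_sup_right h1) (Subgroup.mem_sup_left h2)

/-! ### B. Congruence-subgroup bookkeeping -/

/-- Membership in `Γ(M)` as four divisibilities. [folklore] -/
private lemma mem_Gamma_iff_dvd {M : ℕ} {γ : SL(2, ℤ)} :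
    γ ∈ Gamma M ↔ (M : ℤ) ∣ γ 0 0 - 1 ∧ (M : ℤ) ∣ γ 0 1 ∧ (M : ℤ) ∣ γ 1 0 ∧ (M : ℤ) ∣ γ 1 1 - 1 := by
  rw [Gamma_mem]
  have h1 : ∀ x : ℤ, (x : ZMod M) = 1 ↔ (M : ℤ) ∣ x - 1 := fun x ↦ by
    rw [← ZMod.intCast_zmod_eq_zero_iff_dvd, Int.cast_sub, Int.cast_one, sub_eq_zero]
  simp only [h1, ZMod.intCast_zmod_eq_zero_iff_dvd]

/-- `Γ(N) ∩ Γ(p) ≤ Γ(N p)` for `N`, `p` coprime. [folklore] -/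
private lemma mem_Gamma_mul_of_coprime {N p : ℕ} (hNp : N.Coprime p) {γ : SL(2, ℤ)}
    (hN : γ ∈ Gamma N) (hp : γ ∈ Gamma p) : γ ∈ Gamma (N * p) := by
  rw [mem_Gamma_iff_dvd] at hN hp ⊢
  have hc : IsCoprime (N : ℤ) (p : ℤ) := Nat.isCoprime_iff_coprime.mpr hNp
  push_cast
  exact ⟨hc.mul_dvd hN.1 hp.1, hc.mul_dvd hN.2.1 hp.2.1, hc.mul_dvd hN.2.2.1 hp.2.2.1,
    hc.mul_dvd hN.2.2.2 hp.2.2.2⟩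

/-- `Γ(N p) ≤ Γ(N)`. [folklore] -/
private lemma Gamma_mul_le_left (N p : ℕ) : Gamma (N * p) ≤ Gamma N := by
  intro γ hγ
  rw [mem_Gamma_iff_dvd] at hγ ⊢
  push_cast at hγ
  exact ⟨(dvd_mul_right _ _).trans hγ.1, (dvd_mul_right _ _).trans hγ.2.1,
    (dvd_mul_right _ _).trans hγ.2.2.1, (dvd_mul_right _ _).trans hγ.2.2.2⟩

/-- `Γ(N p) ≤ Γ₀(p)`. [folklore] -/
private lemma Gamma_mul_le_Gamma0 (N p : ℕ) : Gamma (N * p) ≤ Gamma0 p := by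
  intro γ hγ
  rw [mem_Gamma_iff_dvd] at hγ
  rw [Gamma0_mem, ZMod.intCast_zmod_eq_zero_iff_dvd]
  push_cast at hγ
  exact (dvd_mul_left _ _).trans hγ.2.2.1

/-! ### C. Display (4.4.9) -/

/-- **Display (4.4.9)₀ of [cite: CalegariDimitrovTang2025, §4.4, display (4.4.9)], from the
diagonal case of Lemma 4.4.4.** Let `G ≤ SL(2, ℤ)`, `N` and `p` coprime, `A ∈ GL₂(ℝ)` (in CDT
`A = diag(p, 1)`, so that `conjGL G A = A⁻¹ G A ∩ SL₂(ℤ)`). Suppose that for every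
`d ∈ Γ(N) ∩ Γ₀(p)` there is `u ∈ Γ(N) ∩ Γ₀(p)` with `u d⁻¹ ∈ G`, `A u A⁻¹ ∈ G` and `u ≡ d (mod p)` —
the values `(f₁, f₂, π)(u) = (f₁ d, 1, π d)` of the surjection `(f₁, f₂, π) : Γ(N) ∩ Γ₀(p) ↠ S × S × B`
of Lemma 4.4.4 (`S = Γ(N)/(G ∩ Γ(N))`, `B` the Borel of `SL₂(𝔽_p)`). Then
`Γ(N) ∩ Γ₀(p) ≤ ⟨G ∩ Γ(N p), A⁻¹ G A ∩ Γ(N) ∩ Γ₀(p)⟩`: indeed `d = (u d⁻¹)⁻¹ · u` with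
`u d⁻¹ ∈ G ∩ Γ(N) ∩ Γ(p) = G ∩ Γ(N p)` (`= ker (f₁, π)`) and `u ∈ A⁻¹ G A ∩ Γ(N) ∩ Γ₀(p)`
(`= ker f₂`). (CDT state (4.4.9) on `⟨E, Γ(N)⟩ ∩ Γ₀(p)`; on `Γ(N) ∩ Γ₀(p)`, to which their proof of
Lemma 4.4.4 restricts, the kernel of reduction mod `p` is exactly `Γ(N p)`.) -/
theorem Gamma_inf_Gamma0_le_sup_of_forall_exists_conjGL {G : Subgroup SL(2, ℤ)} {N p : ℕ}
    (hNp : N.Coprime p) {A : GL (Fin 2) ℝ}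
    (h : ∀ d ∈ Gamma N ⊓ Gamma0 p, ∃ u ∈ Gamma N ⊓ Gamma0 p,
      u * d⁻¹ ∈ G ∧ u ∈ conjGL G A ∧ u * d⁻¹ ∈ Gamma p) :
    Gamma N ⊓ Gamma0 p ≤ (G ⊓ Gamma (N * p)) ⊔ (conjGL G A ⊓ (Gamma N ⊓ Gamma0 p)) := by
  intro d hd
  obtain ⟨u, hu, hG, hconj, hp⟩ := h d hd
  have hN : u * d⁻¹ ∈ Gamma N := mul_mem hu.1 (inv_mem hd.1)
  have hNp' : (u * d⁻¹)⁻¹ ∈ G ⊓ Gamma (N * p) :=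
    inv_mem (Subgroup.mem_inf.mpr ⟨hG, mem_Gamma_mul_of_coprime hNp hN hp⟩)
  rw [show d = (u * d⁻¹)⁻¹ * u by group]
  exact mul_mem (Subgroup.mem_sup_left hNp') (Subgroup.mem_sup_right ⟨hconj, hu⟩)

/-- **Display (4.4.9)₀ from Lemma 4.4.4 in hypothesis form** [cite: CalegariDimitrovTang2025,
Lemma 4.4.4 and display (4.4.9)]. Lemma 4.4.4 (Serre–Berger, with the Borel factor): for CDT's
group `G = G_N` and a prime `p ∤ N`, the map `(f₁, f₂, π) : Γ(N) ∩ Γ₀(p) → S × S × B`,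
`f₁ x = x G`, `f₂ x = (A x A⁻¹) G`, `π x = x mod p`, is surjective (`S = ⟨E, Γ(N)⟩/G = Γ(N)/(G ∩ Γ(N))`,
`B ⊂ SL₂(𝔽_p)` upper triangular). In hypothesis form, with the classes `s₁ = y₁ G`, `s₂ = y₂ G`,
`b = z mod p` represented by `y₁, y₂ ∈ Γ(N)`, `z ∈ Γ(N) ∩ Γ₀(p)`: for all such there is
`x ∈ Γ(N) ∩ Γ₀(p)` with `x y₁⁻¹ ∈ G`, `(A x A⁻¹) y₂⁻¹ ∈ G` and `x z⁻¹ ∈ Γ(p)`. Consequence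
(4.4.9)₀: `Γ(N) ∩ Γ₀(p) ≤ ⟨G ∩ Γ(N p), A⁻¹ G A ∩ Γ(N) ∩ Γ₀(p)⟩`. -/
theorem Gamma_inf_Gamma0_le_sup_of_surjective {G : Subgroup SL(2, ℤ)} {N p : ℕ}
    (hNp : N.Coprime p) {A : GL (Fin 2) ℝ}
    (h444 : ∀ y₁ ∈ Gamma N, ∀ y₂ ∈ Gamma N, ∀ z ∈ Gamma N ⊓ Gamma0 p,
      ∃ x ∈ Gamma N ⊓ Gamma0 p, x * y₁⁻¹ ∈ G ∧
        (∃ y : SL(2, ℤ), y * y₂⁻¹ ∈ G ∧ (y : GL (Fin 2) ℝ) = A * x * A⁻¹) ∧ x * z⁻¹ ∈ Gamma p) :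
    Gamma N ⊓ Gamma0 p ≤ (G ⊓ Gamma (N * p)) ⊔ (conjGL G A ⊓ (Gamma N ⊓ Gamma0 p)) := by
  refine Gamma_inf_Gamma0_le_sup_of_forall_exists_conjGL hNp fun d hd ↦ ?_
  obtain ⟨x, hx, h1, ⟨y, hy, hyx⟩, h3⟩ := h444 d hd.1 1 (one_mem _) d hd
  exact ⟨x, hx, h1, mem_conjGL.mpr ⟨y, by simpa using hy, hyx⟩, h3⟩

/-- **The groups of (4.4.9) generate a congruence subgroup** [cite: CalegariDimitrovTang2025,
§4.4, proof of Theorem 4.3.1]: under the hypothesis of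
`Gamma_inf_Gamma0_le_sup_of_forall_exists_conjGL`, any subgroup `Γ' ≤ SL(2, ℤ)` containing
`G ∩ Γ(N p)` and `A⁻¹ G A ∩ Γ(N) ∩ Γ₀(p)` contains `Γ(N p)` ("from (4.4.9) we see that these groups
together generate a congruence subgroup"). -/
theorem Gamma_mul_le_of_inf_le_of_conjGL_inf_le {G : Subgroup SL(2, ℤ)} {N p : ℕ}
    (hNp : N.Coprime p) {A : GL (Fin 2) ℝ}
    (h : ∀ d ∈ Gamma N ⊓ Gamma0 p, ∃ u ∈ Gamma N ⊓ Gamma0 p,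
      u * d⁻¹ ∈ G ∧ u ∈ conjGL G A ∧ u * d⁻¹ ∈ Gamma p)
    {Γ' : Subgroup SL(2, ℤ)} (h₁ : G ⊓ Gamma (N * p) ≤ Γ')
    (h₂ : conjGL G A ⊓ (Gamma N ⊓ Gamma0 p) ≤ Γ') : Gamma (N * p) ≤ Γ' :=
  (le_inf (Gamma_mul_le_left N p) (Gamma_mul_le_Gamma0 N p)).trans
    ((Gamma_inf_Gamma0_le_sup_of_forall_exists_conjGL hNp h).trans (sup_le h₁ h₂))


/-! ### D. Theorem 4.3.1 in hypothesis form -/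

section slash

open UpperHalfPlane

variable {k : ℤ}

/-- The stabiliser of a function under the weight-`k` slash action of `SL(2, ℤ)` is a subgroup; in
particular it contains the join of any two subgroups it contains. [folklore] -/
private lemma slash_eq_of_mem_sup {φ : ℍ → ℂ} {H₁ H₂ : Subgroup SL(2, ℤ)}
    (h₁ : ∀ γ ∈ H₁, φ ∣[k] (mapGL ℝ γ) = φ) (h₂ : ∀ γ ∈ H₂, φ ∣[k] (mapGL ℝ γ) = φ)
    {γ : SL(2, ℤ)} (hγ : γ ∈ H₁ ⊔ H₂) : φ ∣[k] (mapGL ℝ γ) = φ := by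
  let S : Subgroup SL(2, ℤ) :=
    { carrier := {x | φ ∣[k] (mapGL ℝ x) = φ}
      mul_mem' := fun {a b} ha hb ↦ by
        simp only [Set.mem_setOf_eq] at ha hb ⊢
        rw [map_mul, SlashAction.slash_mul, ha, hb]
      one_mem' := by
        simp only [Set.mem_setOf_eq, map_one, SlashAction.slash_one]
      inv_mem' := fun {a} ha ↦ by
        simp only [Set.mem_setOf_eq] at ha ⊢
        calc φ ∣[k] (mapGL ℝ a⁻¹) = (φ ∣[k] (mapGL ℝ a)) ∣[k] (mapGL ℝ a⁻¹) := by rw [ha]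
          _ = φ := by
            rw [← SlashAction.slash_mul, ← map_mul, mul_inv_cancel, map_one,
              SlashAction.slash_one] }
  exact sup_le (show H₁ ≤ S from h₁) (show H₂ ≤ S from h₂) hγ

/-- `f ∣ₖ A` is invariant under `conjGL Γ A = A⁻¹ Γ A ∩ SL(2, ℤ)` when `f` is invariant under
`Γ`: for `x` with `A x A⁻¹ = y ∈ Γ`, `(f ∣ₖ A) ∣ₖ x = f ∣ₖ (y A) = f ∣ₖ A`. (For `A = diag(p, 1)`,
`(f ∣ₖ A)(τ) = p^{k-1} f(pτ)`: this is the invariance of `f(pτ)` under `A⁻¹ Γ A ∩ SL₂(ℤ)` of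
[CalegariDimitrovTang2025, §4.3, first paragraph].) [folklore] -/
private lemma slash_slash_eq_of_mem_conjGL {Γ : Subgroup SL(2, ℤ)}
    (f : ModularForm (Γ : Subgroup (GL (Fin 2) ℝ)) k) (A : GL (Fin 2) ℝ) {x : SL(2, ℤ)}
    (hx : x ∈ conjGL Γ A) : (⇑f ∣[k] A) ∣[k] (mapGL ℝ x) = ⇑f ∣[k] A := by
  obtain ⟨y, hy, hyx⟩ := mem_conjGL.mp hx
  have hc : A * mapGL ℝ x = mapGL ℝ y * A := by
    have : (mapGL ℝ y : GL (Fin 2) ℝ) = A * mapGL ℝ x * A⁻¹ := hyx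
    rw [this, inv_mul_cancel_right]
  rw [← SlashAction.slash_mul, hc, SlashAction.slash_mul,
    SlashInvariantForm.slash_action_eqn f _ (Subgroup.mem_map_of_mem _ hy)]

/-- The `GL₂(ℝ)` bookkeeping for `A = diag(p, 1)`: `A y = x A` as soon as `y₀₀ = x₀₀`,
`p y₀₁ = x₀₁`, `y₁₀ = p x₁₀`, `y₁₁ = x₁₁` (i.e. `y = A⁻¹ x A`). [folklore] -/
private lemma diag_mul_mapGL_eq {y x : SL(2, ℤ)} {A : GL (Fin 2) ℝ} {p : ℕ}
    (hA : (A : Matrix (Fin 2) (Fin 2) ℝ) = !![(p : ℝ), 0; 0, 1])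
    (h00 : y 0 0 = x 0 0) (h01 : (p : ℤ) * y 0 1 = x 0 1) (h10 : y 1 0 = p * x 1 0)
    (h11 : y 1 1 = x 1 1) :
    A * mapGL ℝ y = mapGL ℝ x * A := by
  have r00 : ((y 0 0 : ℤ) : ℝ) = x 0 0 := by exact_mod_cast h00
  have r01 : (p : ℝ) * y 0 1 = x 0 1 := by exact_mod_cast h01
  have r10 : ((y 1 0 : ℤ) : ℝ) = p * x 1 0 := by exact_mod_cast h10
  have r11 : ((y 1 1 : ℤ) : ℝ) = x 1 1 := by exact_mod_cast h11
  apply Units.ext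
  simp only [Units.val_mul, mapGL, MonoidHom.coe_comp, Function.comp_apply, coe_GL_coe_matrix,
    map_apply_coe, RingHom.mapMatrix_apply, hA]
  ext i j
  fin_cases i <;> fin_cases j <;>
    simp only [Matrix.mul_apply, Fin.sum_univ_two, Matrix.map_apply, Matrix.of_apply,
      Matrix.cons_val', Matrix.cons_val_zero, Matrix.cons_val_one, Matrix.cons_val_fin_one,
      Matrix.empty_val', eq_intCast, Fin.zero_eta, Fin.mk_one, Fin.isValue]
  · linear_combination (p : ℝ) * r00
  · linear_combination r01
  · linear_combination r10
  · linear_combination r11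

/-- For `A = diag(p, 1)` and `γ ∈ Γ(M p²)`... more precisely `γ ∈ Γ(M p)` with `M p ∣` the
relevant entries: `A⁻¹ γ A ∈ Γ(M)`. Stated as: for `γ ∈ Γ(M p)` there is `y ∈ Γ(M)` with
`A y = γ A`. [folklore] -/
private lemma exists_mem_Gamma_diag_mul_eq {M p : ℕ} (hp : p ≠ 0) {A : GL (Fin 2) ℝ}
    (hA : (A : Matrix (Fin 2) (Fin 2) ℝ) = !![(p : ℝ), 0; 0, 1]) {γ : SL(2, ℤ)}
    (hγ : γ ∈ Gamma (M * p)) : ∃ y ∈ Gamma M, A * mapGL ℝ y = mapGL ℝ γ * A := by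
  obtain ⟨h00, h01, h10, h11⟩ := mem_Gamma_iff_dvd.mp hγ
  push_cast at h00 h01 h10 h11
  obtain ⟨b, hb⟩ : (p : ℤ) ∣ γ 0 1 := (dvd_mul_left _ _).trans h01
  have hdet : γ 0 0 * γ 1 1 - γ 0 1 * γ 1 0 = 1 := by
    have := Matrix.det_fin_two (γ : Matrix (Fin 2) (Fin 2) ℤ)
    rw [γ.det_coe] at this
    exact this.symm
  let y : SL(2, ℤ) := ⟨!![γ 0 0, b; p * γ 1 0, γ 1 1], by
    rw [Matrix.det_fin_two_of]; linear_combination hdet + γ 1 0 * hb⟩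
  refine ⟨y, ?_, diag_mul_mapGL_eq hA rfl (by simp [y, hb]) rfl rfl⟩
  refine mem_Gamma_iff_dvd.mpr ⟨?_, ?_, ?_, ?_⟩ <;>
    simp only [y, Matrix.of_apply, Matrix.cons_val', Matrix.cons_val_zero, Matrix.cons_val_one,
      Matrix.cons_val_fin_one, Matrix.empty_val']
  · exact (dvd_mul_right _ _).trans h00
  · have hp' : (p : ℤ) ≠ 0 := by exact_mod_cast hp
    rw [hb, mul_comm (M : ℤ)] at h01
    exact (mul_dvd_mul_iff_left hp').mp h01
  · exact ((dvd_mul_right (M : ℤ) p).trans h10).mul_left _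
  · exact (dvd_mul_right _ _).trans h11

/-- Bundling (the reverse direction of the tree's `exists_congruence_modularForm_coe_eq_iff`,
re-proved here to keep this file's imports built): a weight-`k` modular form on a finite-index
`Γ ≤ SL(2, ℤ)` which is slash-invariant under some `Γ(M)`, `M ≠ 0`, is the function of a modular
form on the congruence subgroup `Γ(M)` (holomorphy is that of `f`; the cusps of `Γ(M)` and of `Γ`
are those of `SL(2, ℤ)`, Mathlib `Subgroup.IsArithmetic.isCusp_iff_isCusp_SL2Z`). [folklore] -/
private lemma exists_congruence_modularForm_of_forall_slash_eq {Γ : Subgroup SL(2, ℤ)}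
    [Γ.FiniteIndex] (f : ModularForm (Γ : Subgroup (GL (Fin 2) ℝ)) k) {M : ℕ} (hM : M ≠ 0)
    (hinv : ∀ γ ∈ Gamma M, (⇑f : ℍ → ℂ) ∣[k] (mapGL ℝ γ) = ⇑f) :
    ∃ (Γ' : Subgroup SL(2, ℤ)) (g : ModularForm (Γ' : Subgroup (GL (Fin 2) ℝ)) k),
      IsCongruenceSubgroup Γ' ∧ (g : ℍ → ℂ) = f := by
  haveI : NeZero M := ⟨hM⟩
  let g : ModularForm ((Gamma M : Subgroup SL(2, ℤ)) : Subgroup (GL (Fin 2) ℝ)) k :=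
    { toFun := f
      slash_action_eq' := by
        rintro _ ⟨γ, hγ, rfl⟩
        exact hinv γ hγ
      holo' := f.holo'
      bdd_at_cusps' := fun hc ↦ f.bdd_at_cusps'
        ((Subgroup.IsArithmetic.isCusp_iff_isCusp_SL2Z _).mpr
          ((Subgroup.IsArithmetic.isCusp_iff_isCusp_SL2Z _).mp hc)) }
  exact ⟨Gamma M, g, Gamma_is_cong_sub M, rfl⟩

/-- **`f ∣ₖ A` is `Γ(N p)`-invariant** — the heart of [cite: CalegariDimitrovTang2025,
Theorem 4.3.1, proof in §4.4]. Let `G ≤ SL(2, ℤ)`, `N`, `p` coprime, `A ∈ GL₂(ℝ)`, and assume the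
diagonal case of CDT Lemma 4.4.4 (as in `Gamma_inf_Gamma0_le_sup_of_forall_exists_conjGL`). Let
`f` be a weight-`k` modular form on `G`. If `f ∣ₖ A` — for `A = diag(p, 1)` this is
`p^{k-1} f(pτ)`, a form on `A⁻¹ G A ∩ SL₂(ℤ)` — is moreover invariant under `G ∩ Γ(N p)` (as it
is when "`f(pτ)` lies in the `M_{Np}`-algebra generated by `R_N`", all of whose elements are
invariant under `G ∩ ⟨E, Γ(N p)⟩`), then `f ∣ₖ A` is invariant under the congruence subgroup
`Γ(N p)`: it is invariant under `A⁻¹ G A ∩ SL₂(ℤ)` and under `G ∩ Γ(N p)`, which by (4.4.9)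
generate a group containing `Γ(N) ∩ Γ₀(p) ⊇ Γ(N p)`. -/
theorem forall_mem_Gamma_slash_slash_eq_of_forall_exists_conjGL {G : Subgroup SL(2, ℤ)}
    {N p : ℕ} (hNp : N.Coprime p) {A : GL (Fin 2) ℝ}
    (h : ∀ d ∈ Gamma N ⊓ Gamma0 p, ∃ u ∈ Gamma N ⊓ Gamma0 p,
      u * d⁻¹ ∈ G ∧ u ∈ conjGL G A ∧ u * d⁻¹ ∈ Gamma p)
    (f : ModularForm (G : Subgroup (GL (Fin 2) ℝ)) k)
    (hinv : ∀ γ ∈ G ⊓ Gamma (N * p), (⇑f ∣[k] A) ∣[k] (mapGL ℝ γ) = ⇑f ∣[k] A) :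
    ∀ γ ∈ Gamma (N * p), (⇑f ∣[k] A) ∣[k] (mapGL ℝ γ) = ⇑f ∣[k] A := by
  intro γ hγ
  have hmem : γ ∈ (G ⊓ Gamma (N * p)) ⊔ (conjGL G A ⊓ (Gamma N ⊓ Gamma0 p)) :=
    Gamma_mul_le_of_inf_le_of_conjGL_inf_le hNp h le_sup_left le_sup_right hγ
  exact slash_eq_of_mem_sup hinv
    (fun x hx ↦ slash_slash_eq_of_mem_conjGL f A (Subgroup.mem_inf.mp hx).1) hmem

/-- **… hence `f` itself is `Γ(N p²)`-invariant** [cite: CalegariDimitrovTang2025, Theorem 4.3.1,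
proof in §4.4]: "thus `f(pτ)` and `f(τ)` are congruence" — with `A = diag(p, 1)`,
`f = (f ∣ₖ A) ∣ₖ A⁻¹` and `A⁻¹ Γ(N p²) A ⊆ Γ(N p)`. -/
theorem forall_mem_Gamma_slash_eq_of_forall_exists_conjGL {G : Subgroup SL(2, ℤ)}
    {N p : ℕ} (hNp : N.Coprime p) (hp : p ≠ 0) {A : GL (Fin 2) ℝ}
    (hA : (A : Matrix (Fin 2) (Fin 2) ℝ) = !![(p : ℝ), 0; 0, 1])
    (h : ∀ d ∈ Gamma N ⊓ Gamma0 p, ∃ u ∈ Gamma N ⊓ Gamma0 p,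
      u * d⁻¹ ∈ G ∧ u ∈ conjGL G A ∧ u * d⁻¹ ∈ Gamma p)
    (f : ModularForm (G : Subgroup (GL (Fin 2) ℝ)) k)
    (hinv : ∀ γ ∈ G ⊓ Gamma (N * p), (⇑f ∣[k] A) ∣[k] (mapGL ℝ γ) = ⇑f ∣[k] A) :
    ∀ γ ∈ Gamma (N * p * p), (⇑f : ℍ → ℂ) ∣[k] (mapGL ℝ γ) = ⇑f := by
  intro γ hγ
  obtain ⟨y, hy, hAy⟩ := exists_mem_Gamma_diag_mul_eq hp hA hγ
  have hf : (⇑f : ℍ → ℂ) = (⇑f ∣[k] A) ∣[k] A⁻¹ := by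
    rw [← SlashAction.slash_mul, mul_inv_cancel, SlashAction.slash_one]
  have hγA : A⁻¹ * mapGL ℝ γ = mapGL ℝ y * A⁻¹ := by
    rw [inv_mul_eq_iff_eq_mul, ← mul_assoc, hAy, mul_assoc, mul_inv_cancel, mul_one]
  rw [hf, ← SlashAction.slash_mul, hγA, SlashAction.slash_mul,
    forall_mem_Gamma_slash_slash_eq_of_forall_exists_conjGL hNp h f hinv y hy]

/-- **CDT Theorem 4.3.1, hypothesis form** [cite: CalegariDimitrovTang2025, Theorem 4.3.1]. Let
`G ≤ SL(2, ℤ)` be of finite index (CDT's `G = G_N`), `p` a prime not dividing `N` (only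
`N`, `p` coprime and non-zero is used), `A = diag(p, 1) ∈ GL₂(ℝ)`, and assume CDT Lemma 4.4.4 in
the diagonal hypothesis form of `Gamma_inf_Gamma0_le_sup_of_forall_exists_conjGL` (for every
`d ∈ Γ(N) ∩ Γ₀(p)` some `u ∈ Γ(N) ∩ Γ₀(p)` has `u d⁻¹ ∈ G ∩ Γ(p)` and `A u A⁻¹ ∈ G`). If, for a
weight-`k` modular form `f` on `G`, the form `f ∣ₖ A = p^{k-1} f(pτ)` is invariant under
`G ∩ Γ(N p)`, then `f` is a modular form for a congruence subgroup. Contrapositively, as printed: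
if `f` is not modular for any congruence subgroup, then `f(pτ)` is not invariant under
`G ∩ Γ(N p)` — in particular (CDT) it does not lie in the `M_{Np}`-algebra generated by `R_N`.
What this leaves of CDT §4 as input is exactly Lemma 4.4.4 (Serre–Berger surjectivity with the
Borel factor: the amalgam `SL₂(ℤ[1/p])`, the congruence subgroup property, §§4.5–4.6). -/
theorem exists_congruence_modularForm_of_slash_diag_invariant {G : Subgroup SL(2, ℤ)}
    [G.FiniteIndex] {N p : ℕ} (hN : N ≠ 0) (hp : p ≠ 0) (hNp : N.Coprime p) {A : GL (Fin 2) ℝ}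
    (hA : (A : Matrix (Fin 2) (Fin 2) ℝ) = !![(p : ℝ), 0; 0, 1])
    (h : ∀ d ∈ Gamma N ⊓ Gamma0 p, ∃ u ∈ Gamma N ⊓ Gamma0 p,
      u * d⁻¹ ∈ G ∧ u ∈ conjGL G A ∧ u * d⁻¹ ∈ Gamma p)
    (f : ModularForm (G : Subgroup (GL (Fin 2) ℝ)) k)
    (hinv : ∀ γ ∈ G ⊓ Gamma (N * p), (⇑f ∣[k] A) ∣[k] (mapGL ℝ γ) = ⇑f ∣[k] A) :
    ∃ (Γ' : Subgroup SL(2, ℤ)) (g : ModularForm (Γ' : Subgroup (GL (Fin 2) ℝ)) k),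
      IsCongruenceSubgroup Γ' ∧ (g : ℍ → ℂ) = f :=
  exists_congruence_modularForm_of_forall_slash_eq f (mul_ne_zero (mul_ne_zero hN hp) hp)
    (forall_mem_Gamma_slash_eq_of_forall_exists_conjGL hNp hp hA h f hinv)

/-- **CDT Theorem 4.3.1 from Lemma 4.4.4 (Serre–Berger–Borel surjectivity), hypothesis form**
[cite: CalegariDimitrovTang2025, Theorem 4.3.1 and Lemma 4.4.4]. As
`exists_congruence_modularForm_of_slash_diag_invariant`, with the full surjectivity
`(f₁, f₂, π) : Γ(N) ∩ Γ₀(p) ↠ S × S × B` of Lemma 4.4.4 as hypothesis (classes represented by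
`y₁, y₂ ∈ Γ(N)` and `z ∈ Γ(N) ∩ Γ₀(p)`; see `Gamma_inf_Gamma0_le_sup_of_surjective`). -/
theorem exists_congruence_modularForm_of_slash_diag_invariant_of_surjective
    {G : Subgroup SL(2, ℤ)} [G.FiniteIndex] {N p : ℕ} (hN : N ≠ 0) (hp : p ≠ 0)
    (hNp : N.Coprime p) {A : GL (Fin 2) ℝ}
    (hA : (A : Matrix (Fin 2) (Fin 2) ℝ) = !![(p : ℝ), 0; 0, 1])
    (h444 : ∀ y₁ ∈ Gamma N, ∀ y₂ ∈ Gamma N, ∀ z ∈ Gamma N ⊓ Gamma0 p,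
      ∃ x ∈ Gamma N ⊓ Gamma0 p, x * y₁⁻¹ ∈ G ∧
        (∃ y : SL(2, ℤ), y * y₂⁻¹ ∈ G ∧ (y : GL (Fin 2) ℝ) = A * x * A⁻¹) ∧ x * z⁻¹ ∈ Gamma p)
    (f : ModularForm (G : Subgroup (GL (Fin 2) ℝ)) k)
    (hinv : ∀ γ ∈ G ⊓ Gamma (N * p), (⇑f ∣[k] A) ∣[k] (mapGL ℝ γ) = ⇑f ∣[k] A) :
    ∃ (Γ' : Subgroup SL(2, ℤ)) (g : ModularForm (Γ' : Subgroup (GL (Fin 2) ℝ)) k),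
      IsCongruenceSubgroup Γ' ∧ (g : ℍ → ℂ) = f := by
  refine exists_congruence_modularForm_of_slash_diag_invariant hN hp hNp hA (fun d hd ↦ ?_)
    f hinv
  obtain ⟨x, hx, h1, ⟨y, hy, hyx⟩, h3⟩ := h444 d hd.1 1 (one_mem _) d hd
  exact ⟨x, hx, h1, mem_conjGL.mpr ⟨y, by simpa using hy, hyx⟩, h3⟩

end slash

end Literature.NumberTheory.Automorphic

end
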